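import Mathlib
import Summits.RiemannHypothesis.Statement
import Summits.RiemannHypothesis.RiemannHypothesis.Theorems.DeBrangesChainDefs
import Summits.RiemannHypothesis.RiemannHypothesis.Theorems.DeBrangesChainSeparation
import Summits.RiemannHypothesis.RiemannHypothesis.Theorems.DeBrangesChainDoor
import Literature.NumberTheory.LFunctions.SuzukiWeilHilbertSpaceDefs
import Literature.NumberTheory.LFunctions.WeilZeroSum
import Literature.Analysis.UnboundedOperators.HilbertPolyaProofs
import HarnessLib
import HarnessLib.Audit

/-!
# RiemannHypothesis / COLUMN 6 (DBR) — the MINIMAL form of the RH-FREE door `ChainDoorV0`: Weil SIGN + separation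

LINE 1 — LABEL: RH-FREE theorems about an RH-EQUIVALENT criterion (cell rh-crit/dbl, C2 isolation;
records only — director-rh 2026-08-26T03:50:55Z: NO ROUTE for «DeBrangesChain»). bears_on: B-C/B-P
(LADDER-RH §1 COLUMN 6 DBR). WHAT THIS IS NOT: not progress on RH; the declared residual `IsolatedV0`
(M. Suzuki, *On the Hilbert space derived from the Weil distribution*, Canad. J. Math. (2025) =
arXiv:2301.00421, CJM Prop. 5.8 = arXiv v1 Thm. 1.3, conditions (1) ∧ (2) on
`V(0) = L²(0,∞) ∩ 𝖪L²(0,∞)`) stays RH-EQUIVALENT·PRINTED and is nobody's proving target; the door of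
record is `chainDoorV0_proof` (`Theorems/DeBrangesChainDoor.lean`, p419686). Nothing here bears on
the truth of RH.

WHAT IS PROVED (kernel form of the referee's §5.6(b) line, dbl/STATUS 2026-08-26T03:38Z: "the ⟸
mechanism IS Weil-form negativity at a non-real zero"). The printed sufficiency proof (§3.4, p. 7
L129–149) consumes condition (1) `‖ψ‖² = ½⟨ψ,ψ⟩_W` ONLY THROUGH ITS SIGN. Precisely, for ANY set
`V ⊆ L²(ℝ)` closed under subtraction:

* `summable_weilSum_of_separation` — under the separation bounds of condition (2) at `γ₀` and `γ̄₀`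
  (values `c₁`, `c₂` with `|c₁(γ)| ≤ ε|γ₀ − γ|^{−1−δ}` off `γ₀`, `|c₂(γ)| ≤ ε|γ̄₀ − γ|^{−1−δ}` off
  `γ̄₀`, any `δ ≥ 0`), the Weil family `ρ ↦ m(ρ)·c(γ_ρ)·conj c(γ̄_ρ)` of `c = c₁ − c₂` IS summable —
  from the tree's exponent-2 summability D1 (`summable_order_mul_sepWeight_sq`), no hypothesis on the
  location of `γ₀`. (In `weilSum_re_neg_of_separation`, D2, summability came from the `HasSum`
  hypothesis; here it is proved, so that a SIGN hypothesis on unconditional sums is not vacuous.)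
* `riemannHypothesis_of_weilSum_re_nonneg_of_separation` — if every unconditional value `S` of the
  Weil sum of every compatible value assignment of every `ψ ∈ V` has `0 ≤ Re S` (Weil NONNEGATIVITY
  on `V`, the sign of (1) only) and `ZeroSeparationOn V` holds, then RH. Proof = the printed 8 lines:
  off-line `ρ₀` (D3 `exists_offLine_of_not_riemannHypothesis`), witnesses `ψ₁, ψ₂` of (2) at `ρ₀`
  and `1 − ρ̄₀`, `ψ = ψ₁ − ψ₂ ∈ V` with values `c₁ − c₂` (additivity `hasHatValue_sub` — the only
  property of the objects used), the sum EXISTS (previous bullet), its real part is `< 0` (D2) and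
  `≥ 0` (sign hypothesis).
* `weilSum_re_nonneg_of_weilNormIdentityOn` — condition (1) implies the sign hypothesis (uniqueness
  of unconditional sums: `S = 2‖ψ‖²`), so `chainDoorV0_proof` factors through the theorem above
  (`chainDoorV0_of_weilSum_re_nonneg`, stated for `V(0)`); no second proof of `ChainDoorV0` is
  declared.

STATUS OF THE WEAKENED HYPOTHESIS (label bookkeeping, no new residual is declared — residual decls are
the lead's/planner's): "Weil nonnegativity on `V(0)` ∧ `ZeroSeparationOn (suzukiV 0)`" is implied by
`IsolatedV0` (this file) and implies RH (this file); with the PRINTED converse RH ⟹ `IsolatedV0`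
(CJM Thm. 5.5 / Prop. 5.8 ⟹, an RH-CONSEQUENCE not claimed in the tree) it is therefore
RH-EQUIVALENT·PRINTED as well — it is NOT an intermediate rung, exactly as additive slack makes no
rung on the LI side (`LiTheory.riemannHypothesis_iff_exists_slack`). CONVERSE'S STATUS: RH ⟹
`IsolatedV0` remains PRINTED-only in the tree (typed by the cell as a named RH-CONSEQUENCE fact in
`Literature/NumberTheory/LFunctions/SuzukiWeilHilbertSpace.lean`, dbl-t10; discharging it needs the de
Branges-space structure theorems CJM Thm. 5.5, boundary facts F2/F3 of dbl/README §5).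

RECORD NOTES answering the referee's non-blocking notes on the landed (append-only, hence not
re-worded) siblings — dbl/AUDIT-LEDGER.tsv rows 20/26:
* N4 (`DeBrangesChainDefs.lean`, docstring of `ChainDoorV0`): the PRINTED proof takes `ψ̂₁(γ₀) = i`,
  `ψ̂₂(γ̄₀) = −i`, `ψ := ψ₁ + ψ₂` and concludes "`⟨ψ,ψ⟩_W = −m_{γ₀} + O(ε)`" (held text p. 7
  L133–147); OUR kernel proofs (`chainDoorV0_proof`, and the theorems below) use the values `1`, `1`,
  `ψ := ψ₁ − ψ₂` and the honest bound `Re ⟨ψ,ψ⟩_W ≤ −(m_{γ₀} + m_{γ̄₀})/4 + ε² Σ m B²`; the Hermitian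
  pairing makes the two normalisations equivalent (referee N6, verified by hand).
* N9 (`DeBrangesChainDoorOfInputs.lean`): its docstring motivates `chainDoorV0_of_separation` by the
  then-reserved route «DeBrangesChain» closing items by citation; by the director's ruling
  (HOME/INBOX 2026-08-26T03:50:55Z: NO ROUTE — RECORDS) that motivation is moot; the file stands as a
  harmless stand-alone RH-FREE theorem, the door of record being `chainDoorV0_proof`.
-/

noncomputable section

-- D-0017: `Summit.<S>.<S>.…` is the designed namespace of a single-problem summit.
set_option linter.dupNamespace false

namespace Summit.RiemannHypothesis.RiemannHypothesis.Theorems.DeBrangesChain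

open Literature.NumberTheory.LFunctions MeasureTheory Complex Filter Set
open scoped ComplexConjugate Topology

/-! ## Summability of the separated Weil family (exponent 2 from the tree; no location hypothesis) -/

/-- **Summability under separation.** Let `ρ₀` be a non-trivial zero, `γ₀ = γ(ρ₀)`, `δ ≥ 0`, `ε`
real, and `c₁, c₂ : ℂ → ℂ` value assignments with `|c₁(γ_ρ)| ≤ ε|γ₀ − γ_ρ|^{−1−δ}` for `ρ ≠ ρ₀` and
`|c₂(γ_ρ)| ≤ ε|γ̄₀ − γ_ρ|^{−1−δ}` for `ρ ≠ 1 − ρ̄₀`. Then the Weil family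
`ρ ↦ m(ρ)·(c₁ − c₂)(γ_ρ)·conj (c₁ − c₂)(γ̄_ρ)` over the non-trivial zeros is summable: off the (at most
two) indices `ρ₀, 1 − ρ̄₀` each term has norm `≤ ε²·m(ρ)·B(γ_ρ)²` with `B = sepWeight γ₀ δ`, and
`Σ m B² < ∞` is D1 (`summable_order_mul_sepWeight_sq`). RH-FREE; the printed device
"`Σ_γ |γ|^{−1−δ} < ∞`" is not needed. [cite: Suzuki2025WeilHilbertSpace, §3.4 (proof of Thm. 1.3),
p. 7] -/
theorem summable_weilSum_of_separation {ρ₀ : ℂ} (hρ₀ : ρ₀ ∈ ZetaZeros.riemannZetaNontrivialZeros)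
    {δ : ℝ} (hδ : 0 ≤ δ) (ε : ℝ) (c₁ c₂ : ℂ → ℂ)
    (hb₁ : ∀ ρ ∈ ZetaZeros.riemannZetaNontrivialZeros, ρ ≠ ρ₀ →
      ‖c₁ (suzukiZeroParam ρ)‖ ≤ ε / ‖suzukiZeroParam ρ₀ - suzukiZeroParam ρ‖ ^ (1 + δ))
    (hb₂ : ∀ ρ ∈ ZetaZeros.riemannZetaNontrivialZeros, ρ ≠ 1 - conj ρ₀ →
      ‖c₂ (suzukiZeroParam ρ)‖ ≤
        ε / ‖suzukiZeroParam (1 - conj ρ₀) - suzukiZeroParam ρ‖ ^ (1 + δ)) :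
    Summable (fun ρ : ZetaZeros.riemannZetaNontrivialZeros ↦
      (riemannZetaZeroOrder (ρ : ℂ) : ℂ) *
        (c₁ (suzukiZeroParam ρ) - c₂ (suzukiZeroParam ρ)) *
        conj (c₁ (conj (suzukiZeroParam ρ)) - c₂ (conj (suzukiZeroParam ρ)))) := by
  classical
  set γ₀ := suzukiZeroParam ρ₀ with hγ₀def
  have hρ₁ : 1 - conj ρ₀ ∈ ZetaZeros.riemannZetaNontrivialZeros :=
    ZetaZeros.riemannZetaNontrivialZeros.one_sub_conj_mem hρ₀
  have hγ₁ : suzukiZeroParam (1 - conj ρ₀) = conj γ₀ := suzukiZeroParam_one_sub_conj ρ₀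
  have hm0 : ∀ ρ : ZetaZeros.riemannZetaNontrivialZeros, (0 : ℝ) ≤ riemannZetaZeroOrder (ρ : ℂ) :=
    fun ρ ↦ by
      have h1 := ZetaZeros.riemannZetaNontrivialZeros.one_le_order ρ.2
      exact_mod_cast (show (0 : ℤ) ≤ _ by omega)
  set f : ZetaZeros.riemannZetaNontrivialZeros → ℂ := fun ρ ↦
    (riemannZetaZeroOrder (ρ : ℂ) : ℂ) * (c₁ (suzukiZeroParam ρ) - c₂ (suzukiZeroParam ρ)) *
      conj (c₁ (conj (suzukiZeroParam ρ)) - c₂ (conj (suzukiZeroParam ρ))) with hfdef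
  set z₀ : ZetaZeros.riemannZetaNontrivialZeros := ⟨ρ₀, hρ₀⟩ with hz₀
  set z₁ : ZetaZeros.riemannZetaNontrivialZeros := ⟨1 - conj ρ₀, hρ₁⟩ with hz₁
  -- tail terms: ‖f ρ‖ ≤ ε² m B² off {z₀, z₁}
  have htail : ∀ ρ : ZetaZeros.riemannZetaNontrivialZeros, ρ ≠ z₀ → ρ ≠ z₁ →
      ‖f ρ‖ ≤ ε ^ 2 * ((riemannZetaZeroOrder (ρ : ℂ) : ℝ) *
        sepWeight γ₀ δ (suzukiZeroParam ρ) ^ 2) := by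
    intro ρ hρ0 hρ1
    have hρ0' : (ρ : ℂ) ≠ ρ₀ := fun h ↦ hρ0 (Subtype.ext h)
    have hρ1' : (ρ : ℂ) ≠ 1 - conj ρ₀ := fun h ↦ hρ1 (Subtype.ext h)
    -- reflected index
    have hρs : 1 - conj (ρ : ℂ) ∈ ZetaZeros.riemannZetaNontrivialZeros :=
      ZetaZeros.riemannZetaNontrivialZeros.one_sub_conj_mem ρ.2
    have hρs0 : 1 - conj (ρ : ℂ) ≠ ρ₀ := by
      intro h; apply hρ1'
      rw [← h]; simp
    have hρs1 : 1 - conj (ρ : ℂ) ≠ 1 - conj ρ₀ := by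
      intro h; apply hρ0'
      have := congrArg (fun w ↦ conj (1 - w)) h
      simpa using this
    have hγs : suzukiZeroParam (1 - conj (ρ : ℂ)) = conj (suzukiZeroParam ρ) :=
      suzukiZeroParam_one_sub_conj _
    -- the two factor bounds
    have hB : ‖c₁ (suzukiZeroParam ρ) - c₂ (suzukiZeroParam ρ)‖ ≤
        ε * sepWeight γ₀ δ (suzukiZeroParam ρ) := by
      have e1 := hb₁ ρ ρ.2 hρ0'
      have e2 := hb₂ ρ ρ.2 hρ1'
      rw [hγ₁] at e2
      calc ‖c₁ (suzukiZeroParam ρ) - c₂ (suzukiZeroParam ρ)‖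
          ≤ ‖c₁ (suzukiZeroParam ρ)‖ + ‖c₂ (suzukiZeroParam ρ)‖ := norm_sub_le _ _
        _ ≤ ε / ‖γ₀ - suzukiZeroParam ρ‖ ^ (1 + δ) +
            ε / ‖conj γ₀ - suzukiZeroParam ρ‖ ^ (1 + δ) := add_le_add e1 e2
        _ = ε * sepWeight γ₀ δ (suzukiZeroParam ρ) := by unfold sepWeight; ring
    have hB' : ‖c₁ (conj (suzukiZeroParam ρ)) - c₂ (conj (suzukiZeroParam ρ))‖ ≤
        ε * sepWeight γ₀ δ (suzukiZeroParam ρ) := by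
      have e1 := hb₁ (1 - conj (ρ : ℂ)) hρs hρs0
      have e2 := hb₂ (1 - conj (ρ : ℂ)) hρs hρs1
      rw [hγs] at e1 e2
      rw [hγ₁] at e2
      rw [← sepWeight_conj]
      calc ‖c₁ (conj (suzukiZeroParam ρ)) - c₂ (conj (suzukiZeroParam ρ))‖
          ≤ ‖c₁ (conj (suzukiZeroParam ρ))‖ + ‖c₂ (conj (suzukiZeroParam ρ))‖ := norm_sub_le _ _
        _ ≤ ε / ‖γ₀ - conj (suzukiZeroParam ρ)‖ ^ (1 + δ) +
            ε / ‖conj γ₀ - conj (suzukiZeroParam ρ)‖ ^ (1 + δ) := add_le_add e1 e2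
        _ = ε * sepWeight γ₀ δ (conj (suzukiZeroParam ρ)) := by unfold sepWeight; ring
    have hεB : 0 ≤ ε * sepWeight γ₀ δ (suzukiZeroParam ρ) := (norm_nonneg _).trans hB
    calc ‖f ρ‖ = (riemannZetaZeroOrder (ρ : ℂ) : ℝ) *
          (‖c₁ (suzukiZeroParam ρ) - c₂ (suzukiZeroParam ρ)‖ *
            ‖c₁ (conj (suzukiZeroParam ρ)) - c₂ (conj (suzukiZeroParam ρ))‖) := by
          simp only [hfdef, norm_mul, Complex.norm_conj, Complex.norm_intCast]
          rw [abs_of_nonneg (hm0 ρ)]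
          ring
      _ ≤ (riemannZetaZeroOrder (ρ : ℂ) : ℝ) *
          ((ε * sepWeight γ₀ δ (suzukiZeroParam ρ)) * (ε * sepWeight γ₀ δ (suzukiZeroParam ρ))) :=
          mul_le_mul_of_nonneg_left (mul_le_mul hB hB' (norm_nonneg _) hεB) (hm0 ρ)
      _ = ε ^ 2 * ((riemannZetaZeroOrder (ρ : ℂ) : ℝ) * sepWeight γ₀ δ (suzukiZeroParam ρ) ^ 2) := by
          ring
  -- summable off the finite set {z₀, z₁} by comparison with ε² · (m B²), D1
  set s : Finset ZetaZeros.riemannZetaNontrivialZeros := {z₀, z₁} with hsdef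
  have hBsum := summable_order_mul_sepWeight_sq γ₀ hδ
  have hgs : Summable (fun x : {x // x ∉ s} ↦ ε ^ 2 *
      ((riemannZetaZeroOrder ((x : ZetaZeros.riemannZetaNontrivialZeros) : ℂ) : ℝ) *
        sepWeight γ₀ δ (suzukiZeroParam (x : ZetaZeros.riemannZetaNontrivialZeros)) ^ 2)) :=
    (hBsum.subtype _).mul_left (ε ^ 2)
  have htail' : ∀ x : {x // x ∉ s}, ‖f x‖ ≤ ε ^ 2 *
      ((riemannZetaZeroOrder ((x : ZetaZeros.riemannZetaNontrivialZeros) : ℂ) : ℝ) *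
        sepWeight γ₀ δ (suzukiZeroParam (x : ZetaZeros.riemannZetaNontrivialZeros)) ^ 2) := by
    intro x
    have hx := x.2
    simp only [hsdef, Finset.mem_insert, Finset.mem_singleton, not_or] at hx
    exact htail x hx.1 hx.2
  have hcompl : Summable (fun x : {x // x ∉ s} ↦ f x) :=
    Summable.of_norm_bounded hgs htail'
  exact (s.summable_compl_iff).1 hcompl

/-! ## The door from the Weil SIGN and separation (generic `V`, then `V(0)`) -/

/-- **The minimal RH-FREE door: Weil NONNEGATIVITY + separation ⟹ RH** (the printed sufficiency
argument of [Su25c] Thm. 1.3 uses condition (1) only through its sign). Let `V ⊆ L²(ℝ)` be closed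
under subtraction. Suppose (sign) for every `ψ ∈ V` and every value assignment `c` compatible with
`HasHatValue ψ` on `Γ`, every unconditional sum `S` of `ρ ↦ m(ρ)·c(γ_ρ)·conj c(γ̄_ρ)` has `0 ≤ Re S`;
and (2) `ZeroSeparationOn V`. Then the Riemann hypothesis holds: otherwise an off-line zero `ρ₀`
(D3), the witnesses `ψ₁, ψ₂ ∈ V` of (2) at `ρ₀`, `1 − ρ̄₀` with D2's `ε`, `ψ = ψ₁ − ψ₂ ∈ V` with
values `c₁ − c₂` (additivity of the evaluation), a summable Weil family
(`summable_weilSum_of_separation`) whose sum has `Re < 0` (D2, `weilSum_re_neg_of_separation`) and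
`Re ≥ 0` (sign) — contradiction. RH-FREE theorem about RH-EQUIVALENT hypotheses; not progress on RH.
[cite: Suzuki2025WeilHilbertSpace, Thm. 1.3 (proof of sufficiency, §3.4), p. 7] -/
theorem riemannHypothesis_of_weilSum_re_nonneg_of_separation
    {V : Set (Lp ℂ 2 (volume : Measure ℝ))}
    (hV : ∀ f ∈ V, ∀ g ∈ V, f - g ∈ V)
    (hpos : ∀ ψ ∈ V, ∀ c : ℂ → ℂ,
      (∀ ρ ∈ ZetaZeros.riemannZetaNontrivialZeros,
          HasHatValue ψ (suzukiZeroParam ρ) (c (suzukiZeroParam ρ))) →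
        ∀ S : ℂ, HasSum (fun ρ : ZetaZeros.riemannZetaNontrivialZeros ↦
            (riemannZetaZeroOrder (ρ : ℂ) : ℂ) * c (suzukiZeroParam ρ) *
              conj (c (conj (suzukiZeroParam ρ)))) S → 0 ≤ S.re)
    (hsep : ZeroSeparationOn V) : _root_.RiemannHypothesis := by
  classical
  by_contra hRH
  obtain ⟨ρ₀, hρ₀, hoff⟩ := exists_offLine_of_not_riemannHypothesis hRH
  obtain ⟨δ, hδ, hsep⟩ := hsep
  obtain ⟨ε, hε, hneg⟩ := weilSum_re_neg_of_separation hρ₀ hoff hδ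
  have hρ₁ : 1 - conj ρ₀ ∈ ZetaZeros.riemannZetaNontrivialZeros :=
    ZetaZeros.riemannZetaNontrivialZeros.one_sub_conj_mem hρ₀
  obtain ⟨ψ₁, hψ₁V, hψ₁one, hψ₁bd⟩ := hsep ρ₀ hρ₀ ε hε
  obtain ⟨ψ₂, hψ₂V, hψ₂one, hψ₂bd⟩ := hsep (1 - conj ρ₀) hρ₁ ε hε
  choose! v₁ hv₁ hv₁b using hψ₁bd
  choose! v₂ hv₂ hv₂b using hψ₂bd
  -- total value assignments on `ℂ` (only their values on `Γ` matter)
  set c₁ : ℂ → ℂ := Function.update (fun z ↦ v₁ (1 / 2 - I * z)) (suzukiZeroParam ρ₀) 1 with hc₁def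
  set c₂ : ℂ → ℂ := Function.update (fun z ↦ v₂ (1 / 2 - I * z)) (suzukiZeroParam (1 - conj ρ₀)) 1
    with hc₂def
  have hc₁₀ : c₁ (suzukiZeroParam ρ₀) = 1 := by
    simp only [hc₁def, Function.update_self]
  have hc₂₀ : c₂ (suzukiZeroParam (1 - conj ρ₀)) = 1 := by
    simp only [hc₂def, Function.update_self]
  have hc₁ : ∀ ρ : ℂ, ρ ≠ ρ₀ → c₁ (suzukiZeroParam ρ) = v₁ ρ := by
    intro ρ h
    simp only [hc₁def, Function.update_of_ne (suzukiZeroParam_injective.ne h),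
      one_half_sub_I_mul_suzukiZeroParam]
  have hc₂ : ∀ ρ : ℂ, ρ ≠ 1 - conj ρ₀ → c₂ (suzukiZeroParam ρ) = v₂ ρ := by
    intro ρ h
    simp only [hc₂def, Function.update_of_ne (suzukiZeroParam_injective.ne h),
      one_half_sub_I_mul_suzukiZeroParam]
  -- `ψ := ψ₁ − ψ₂ ∈ V` with values `c₁ − c₂`
  have hψV : ψ₁ - ψ₂ ∈ V := hV ψ₁ hψ₁V ψ₂ hψ₂V
  have hvals : ∀ ρ ∈ ZetaZeros.riemannZetaNontrivialZeros,
      HasHatValue (ψ₁ - ψ₂) (suzukiZeroParam ρ)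
        ((fun z ↦ c₁ z - c₂ z) (suzukiZeroParam ρ)) := by
    intro ρ hρ
    refine hasHatValue_sub ?_ ?_
    · by_cases h : ρ = ρ₀
      · rw [h, hc₁₀]; exact hψ₁one
      · rw [hc₁ ρ h]; exact hv₁ ρ hρ h
    · by_cases h : ρ = 1 - conj ρ₀
      · rw [h, hc₂₀]; exact hψ₂one
      · rw [hc₂ ρ h]; exact hv₂ ρ hρ h
  have hb1 : ∀ ρ ∈ ZetaZeros.riemannZetaNontrivialZeros, ρ ≠ ρ₀ →
      ‖c₁ (suzukiZeroParam ρ)‖ ≤ ε / ‖suzukiZeroParam ρ₀ - suzukiZeroParam ρ‖ ^ (1 + δ) := by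
    intro ρ hρ h; rw [hc₁ ρ h]; exact hv₁b ρ hρ h
  have hb2 : ∀ ρ ∈ ZetaZeros.riemannZetaNontrivialZeros, ρ ≠ 1 - conj ρ₀ →
      ‖c₂ (suzukiZeroParam ρ)‖ ≤
        ε / ‖suzukiZeroParam (1 - conj ρ₀) - suzukiZeroParam ρ‖ ^ (1 + δ) := by
    intro ρ hρ h; rw [hc₂ ρ h]; exact hv₂b ρ hρ h
  have h2 : c₂ (conj (suzukiZeroParam ρ₀)) = 1 := by
    rw [← suzukiZeroParam_one_sub_conj]; exact hc₂₀
  -- the Weil family of `c₁ − c₂` is summable (D1), so its sum `S` exists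
  have hsumm := summable_weilSum_of_separation hρ₀ hδ.le ε c₁ c₂ hb1 hb2
  obtain ⟨S, hS⟩ := hsumm
  -- sign hypothesis: `0 ≤ Re S`; D2: `Re S < 0`
  have hge : 0 ≤ S.re := hpos (ψ₁ - ψ₂) hψV (fun z ↦ c₁ z - c₂ z) hvals S hS
  have hlt : S.re < 0 := hneg c₁ c₂ hc₁₀ h2 hb1 hb2 S hS
  exact absurd hge (not_le.mpr hlt)

/-- **Condition (1) implies the sign hypothesis** (on any `V`): if `WeilNormIdentityOn V`, then every
unconditional sum `S` of the Weil family of a compatible value assignment of `ψ ∈ V` equals `2‖ψ‖²`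
(uniqueness of sums), so `0 ≤ Re S`. Hence the door of record `chainDoorV0_proof : IsolatedV0 → RH`
factors through `riemannHypothesis_of_weilSum_re_nonneg_of_separation`. RH-FREE.
[cite: Suzuki2025WeilHilbertSpace, Thm. 1.3 (1), p. 3] -/
theorem weilSum_re_nonneg_of_weilNormIdentityOn {V : Set (Lp ℂ 2 (volume : Measure ℝ))}
    (h1 : WeilNormIdentityOn V) :
    ∀ ψ ∈ V, ∀ c : ℂ → ℂ,
      (∀ ρ ∈ ZetaZeros.riemannZetaNontrivialZeros,
          HasHatValue ψ (suzukiZeroParam ρ) (c (suzukiZeroParam ρ))) →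
        ∀ S : ℂ, HasSum (fun ρ : ZetaZeros.riemannZetaNontrivialZeros ↦
            (riemannZetaZeroOrder (ρ : ℂ) : ℂ) * c (suzukiZeroParam ρ) *
              conj (c (conj (suzukiZeroParam ρ)))) S → 0 ≤ S.re := by
  intro ψ hψ c hc S hS
  have h := h1 ψ hψ c hc
  rw [hS.unique h, Complex.ofReal_re]
  positivity

/-- **The minimal door at `V(0)`**: Weil nonnegativity on Suzuki's RH-free space
`V(0) = L²(0,∞) ∩ 𝖪L²(0,∞)` (`suzukiV 0`, closed under subtraction by the additivity of `𝖪`,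
`sub_mem_suzukiV`) together with `ZeroSeparationOn (suzukiV 0)` implies RH. Composed with
`weilSum_re_nonneg_of_weilNormIdentityOn` this is `chainDoorV0_proof` again (no second proof of
`ChainDoorV0` is declared). LABEL: RH-FREE theorem; its hypotheses' conjunction is
RH-EQUIVALENT·PRINTED (implied by `IsolatedV0`, implies RH; converse via the printed RH ⟹
`IsolatedV0`), not an intermediate rung. [cite: Suzuki2025WeilHilbertSpace, Thm. 1.3 (proof of
sufficiency, §3.4), p. 7] -/
theorem chainDoorV0_of_weilSum_re_nonneg
    (hpos : ∀ ψ ∈ suzukiV 0, ∀ c : ℂ → ℂ,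
      (∀ ρ ∈ ZetaZeros.riemannZetaNontrivialZeros,
          HasHatValue ψ (suzukiZeroParam ρ) (c (suzukiZeroParam ρ))) →
        ∀ S : ℂ, HasSum (fun ρ : ZetaZeros.riemannZetaNontrivialZeros ↦
            (riemannZetaZeroOrder (ρ : ℂ) : ℂ) * c (suzukiZeroParam ρ) *
              conj (c (conj (suzukiZeroParam ρ)))) S → 0 ≤ S.re)
    (hsep : ZeroSeparationOn (suzukiV 0)) : _root_.RiemannHypothesis :=
  riemannHypothesis_of_weilSum_re_nonneg_of_separation (V := suzukiV 0)
    (fun _ hf _ hg ↦ sub_mem_suzukiV hf hg) hpos hsep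

/-- **`IsolatedV0` through the minimal door** (the factorisation, as a theorem with the residual as
HYPOTHESIS — the residual is never claimed): `IsolatedV0 → RiemannHypothesis` obtained by composing
`weilSum_re_nonneg_of_weilNormIdentityOn` with `chainDoorV0_of_weilSum_re_nonneg`; definitionally the
statement `ChainDoorV0`, whose theorem of record stays `chainDoorV0_proof`. RH-FREE.
[cite: Suzuki2025WeilHilbertSpace, Thm. 1.3 (proof of sufficiency, §3.4), p. 7] -/
theorem riemannHypothesis_of_isolatedV0_via_weilSign (hI : IsolatedV0) : _root_.RiemannHypothesis :=
  chainDoorV0_of_weilSum_re_nonneg (weilSum_re_nonneg_of_weilNormIdentityOn hI.1) hI.2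

end Summit.RiemannHypothesis.RiemannHypothesis.Theorems.DeBrangesChain


namespace Summit.RiemannHypothesis.RiemannHypothesis.Theorems.DeBrangesChain

open Literature.NumberTheory.LFunctions MeasureTheory Complex Filter Set
open scoped ComplexConjugate Topology

/-! ## Condition (2) forces `V ≠ {0}` (kernel form of dbl/RESIDUAL.md v1 §1.5 and the referee's A4)

The cell's residual analysis says: "the second conjunct implies `V(0) ≠ {0}`, which Suzuki leaves
OPEN unconditionally" ([Su25c] p. 3 L41–44; CJM §5: "we expect that `V(t) ≠ {0}` …"), and the
referee's A4 audit point (dbl/STATUS 2026-08-26T03:38Z): "`V(0) = {0}` makes Cond2 FALSE (value `1`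
unreachable), not vacuously true". Kernel form: the zero class of `L²(ℝ)` has only the value `0`
under the relational evaluation (all three clauses), so a witness of condition (2) is a NONZERO
element of `V`; with one non-trivial zero in hand (the tree's Hardy theorem,
`Literature.Analysis.UnboundedOperators.infinite_riemannZetaNontrivialZeros`), `IsolatedV0` — indeed
`ZeroSeparationOn (suzukiV 0)` alone — gives `V(0) ≠ {0}`. RH-FREE; Suzuki's question (is
`V(0) ≠ {0}` unconditionally?) is NOT answered here and is nobody's target.
-/

/-- `𝖪 0 = 0` (additivity of `𝖪`). RH-FREE plumbing.
[cite: Suzuki2025WeilHilbertSpace, p. 2 ("𝖪 is … ℝ-linear")] -/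
theorem suzukiK_zero : suzukiK (0 : Lp ℂ 2 (volume : Measure ℝ)) = 0 := by
  have h := suzukiK_sub (0 : Lp ℂ 2 (volume : Measure ℝ)) 0
  rwa [sub_zero, sub_self] at h

/-- The half-line transform of the zero class vanishes: `∫₀^∞ 0·e^{izx}dx = 0` (the class `0` is
a.e. zero). RH-FREE plumbing. [cite: Suzuki2025WeilHilbertSpace, p. 2 ("f̂(z) = (𝖥f)(z) := ∫ f(x)e^{izx}dx")] -/
theorem upperHalfHat_zero (z : ℂ) :
    upperHalfHat ((0 : Lp ℂ 2 (volume : Measure ℝ)) : ℝ → ℂ) z = 0 := by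
  unfold upperHalfHat
  have h : (fun x : ℝ ↦ ((0 : Lp ℂ 2 (volume : Measure ℝ)) : ℝ → ℂ) x * cexp (I * z * x))
      =ᵐ[volume.restrict (Set.Ioi (0 : ℝ))] fun _ ↦ 0 := by
    filter_upwards [ae_restrict_of_ae (Lp.coeFn_zero ℂ 2 (volume : Measure ℝ))] with x hx
    rw [hx, Pi.zero_apply, zero_mul]
  rw [integral_congr_ae h, integral_zero]

/-- **The zero class has only the value `0`**: `HasHatValue 0 γ c → c = 0`, in each of the three
clauses (`Im γ > 0`: the integral of `0`; `Im γ < 0`: `Θ_ξ(γ)·conj 0` since `𝖪0 = 0`; `Im γ = 0`: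
the limit of the constant `0`). Hence the value `1` demanded by condition (2) is unreachable in
`V = {0}` (referee A4: condition (2) is FALSE, not vacuous, on the zero space). RH-FREE.
[cite: Suzuki2025WeilHilbertSpace, Thm. 1.3 (2), p. 3] -/
theorem eq_zero_of_hasHatValue_zero {γ c : ℂ}
    (h : HasHatValue (0 : Lp ℂ 2 (volume : Measure ℝ)) γ c) : c = 0 := by
  rcases h with ⟨-, rfl⟩ | ⟨-, rfl⟩ | ⟨-, h⟩
  · exact upperHalfHat_zero γ
  · rw [suzukiK_zero, upperHalfHat_zero, map_zero, mul_zero]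
  · have h0 : Tendsto (fun y : ℝ ↦ upperHalfHat ((0 : Lp ℂ 2 (volume : Measure ℝ)) : ℝ → ℂ)
        (γ + I * y)) (𝓝[>] 0) (𝓝 0) := by
      simp only [upperHalfHat_zero]
      exact tendsto_const_nhds
    exact tendsto_nhds_unique h h0

/-- **Condition (2) produces a nonzero element of `V`** at every non-trivial zero `ρ`: the witness
`ψ ∈ V` with `ψ̂(γ_ρ) = 1` cannot be the zero class (`eq_zero_of_hasHatValue_zero`). RH-FREE.
[cite: Suzuki2025WeilHilbertSpace, Thm. 1.3 (2), p. 3] -/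
theorem exists_ne_zero_of_zeroSeparationOn {V : Set (Lp ℂ 2 (volume : Measure ℝ))}
    (h : ZeroSeparationOn V) {ρ : ℂ} (hρ : ρ ∈ ZetaZeros.riemannZetaNontrivialZeros) :
    ∃ ψ ∈ V, ψ ≠ 0 := by
  obtain ⟨δ, -, h⟩ := h
  obtain ⟨ψ, hψV, h1, -⟩ := h ρ hρ 1 one_pos
  refine ⟨ψ, hψV, ?_⟩
  rintro rfl
  exact one_ne_zero (eq_zero_of_hasHatValue_zero h1)

/-- **`ZeroSeparationOn (suzukiV 0)` — a fortiori `IsolatedV0` — implies `V(0) ≠ {0}`** (kernel form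
of dbl/RESIDUAL.md v1 §1.5): there IS a non-trivial zero (Hardy's theorem in the tree:
`infinite_riemannZetaNontrivialZeros`), and condition (2) at it produces a nonzero element of
`V(0)`. RH-FREE theorem about the RH-EQUIVALENT residual's second conjunct; Suzuki's open question
"`V(0) ≠ {0}` unconditionally?" (p. 3 L41–44) is untouched. [cite: Suzuki2025WeilHilbertSpace, §1 p. 3 ("it is interesting to prove or disprove V(0) ≠ {0} unconditionally")] -/
theorem exists_mem_suzukiV_ne_zero_of_zeroSeparationOn (h : ZeroSeparationOn (suzukiV 0)) :
    ∃ ψ ∈ suzukiV 0, ψ ≠ 0 := by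
  obtain ⟨ρ, hρ⟩ := Literature.Analysis.UnboundedOperators.infinite_riemannZetaNontrivialZeros.nonempty
  exact exists_ne_zero_of_zeroSeparationOn h hρ

/-- **`IsolatedV0 → V(0) ≠ {0}`** (the residual as HYPOTHESIS, never claimed): immediate from its
second conjunct. RH-FREE. [cite: Suzuki2025WeilHilbertSpace, Thm. 1.3 (2), p. 3] -/
theorem exists_mem_suzukiV_ne_zero_of_isolatedV0 (hI : IsolatedV0) : ∃ ψ ∈ suzukiV 0, ψ ≠ 0 :=
  exists_mem_suzukiV_ne_zero_of_zeroSeparationOn hI.2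

end Summit.RiemannHypothesis.RiemannHypothesis.Theorems.DeBrangesChain

end
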